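import Literature.Topology.FourManifolds.K2Lite
import Literature.Topology.FourManifolds.KirbyMovesSlideFinger
import Literature.Topology.FourManifolds.RebuildLowerArchFormulas
import Literature.Topology.FourManifolds.RebuildUpperArchFormulas
import HarnessLib

/-!
# The loop of the slid attaching circle as a height graph, and the finger move of `Kᵢ`

Topic `Literature/Topology/FourManifolds`; fact seat `provefact-IsStrictHandleSlide.isSurgery`
(R. C. Kirby, *The Topology of 4-Manifolds*, LNM 1374 (1989), Ch. I §4, Fig. 4.2: before the slide
the attaching circle `Kᵢ` is pushed across the band into a finger whose tip sits just outside the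
push-off `Kⱼ'`; remaining content: the named fact (S)
`Literature.Topology.FourManifolds.FramedLink.IsStrictHandleSlide.slideModel`). The finger knot
`K₁` is the graph `x₀ = ρ (height)` over the left edge of the band (`BandData.exists_ambientIsotopy_edgeGraph`,
`KirbyMovesSlideFinger.lean`); this file

* (Part A, `K1LoopData`) writes the height profile `ρ` of that loop: the rise of the lower track
  (`K2LiteData.ρ₁`, `K2Lite.lean`) up to the tip height `h_D`, a blend into the constant-radius arc
  `x₀ = 1 - (r_low - 1)/e (h)` (slice radius `r_low`, just outside the push-off) across the middle
  heights, and the mirror image of the rise of the (reflected) upper track from `h_Dᵘ` on; proves it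
  `C^∞` with values in `[0, 1]`, equal to the two rises outside `(h_D, h_Dᵘ)` and `0` outside the
  window;
* (Part B, `BandCore.exists_ambientIsotopy_heightGraph`) realises **any** `C^∞` profile
  `ρ : ℝ → [0, 1]` vanishing below `fLo (alo + epsLo)` and above `fUp (ahi - epsHi)` as the end of an
  ambient isotopy of `S³` moving `A` inside the band: the knot `k₁` with
  `k₁ (circlePt s) = band (ρ (fLo s), fLo s)` on the edge window and `= A` off it, the isotopy being
  stationary off any open set containing the moving band points (the finger move of the slide).

## References

* R. C. Kirby, *The Topology of 4-Manifolds*, LNM 1374, Springer (1989), Ch. I §4. [Kirby1989]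
-/

open scoped Manifold ContDiff Topology
open Set Real Filter Function

noncomputable section

namespace Literature.Topology.FourManifolds

/-! ## Part A: the height profile of the loop -/

/-- **Data of the loop profile**: the lower and the (reflected) upper track data, the edge rate
`e` of the flat strip (slice radius `1 + (1 - x₀) e (h)` at the band point `(x₀, h)`), the radius
`r_low` of the fingertip arc, the blend width `β`. [cite: Kirby1989, Ch. I §4] -/
structure K1LoopData where
  dl : K2LiteData
  du : K2LiteData
  e : ℝ → ℝ
  rlow : ℝ
  β : ℝ
  e_smooth : ContDiffOn ℝ ∞ e (Ioo 10⁻¹ (9 / 10))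
  e_pos : ∀ h ∈ Icc (0.12 : ℝ) 0.88, 0 < e h
  rlow_gt : 1 < rlow
  rlow_lt : ∀ h ∈ Icc (0.12 : ℝ) 0.88, rlow - 1 < e h
  β_pos : 0 < β
  /-- The two blend zones `[h_D, h_D + β]`, `[h_Dᵘ - β, h_Dᵘ]` are separated. -/
  sep : dl.Hh dl.tD + β < 1 - du.Hh du.tD - β

namespace K1LoopData

variable (L : K1LoopData)

/-- The lower tip height `h_D = Hh t_D`. [folklore] -/
def hD : ℝ := L.dl.Hh L.dl.tD

/-- The upper tip height `h_Dᵘ = 1 - Hhᵘ t_Dᵘ`. [folklore] -/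
def hDu : ℝ := 1 - L.du.Hh L.du.tD

/-- The rise of the lower track as a height profile. [folklore] -/
def ρlo (h : ℝ) : ℝ := L.dl.ρ₁ h

/-- The rise of the upper track as a height profile (reflected heights). [folklore] -/
def ρup (h : ℝ) : ℝ := L.du.ρ₁ (1 - h)

/-- The constant-radius arc `x₀ = 1 - (r_low - 1)/e` (heights squashed into the window). [folklore] -/
def ρc (h : ℝ) : ℝ := 1 - (L.rlow - 1) / L.e (heightSquash h)

/-- The lower blend step. [folklore] -/
def T (h : ℝ) : ℝ := smoothStep L.hD (L.hD + L.β) h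

/-- The upper blend step. [folklore] -/
def Tu (h : ℝ) : ℝ := smoothStep (L.hDu - L.β) L.hDu h

/-- The middle profile: the arc blended into the upper rise. [folklore] -/
def ρmid (h : ℝ) : ℝ := (1 - L.Tu h) * L.ρc h + L.Tu h * L.ρup h

/-- **The height profile of the loop.** [cite: Kirby1989, Ch. I §4] -/
def rho (h : ℝ) : ℝ := (1 - L.T h) * L.ρlo h + L.T h * L.ρmid h

/-- `hD_lt_hDu` (auxiliary). [folklore] -/
theorem hD_lt_hDu : L.hD < L.hDu := by have := L.sep; rw [hD, hDu]; linarith [L.β_pos]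

/-- `T_lt` (auxiliary). [folklore] -/
theorem T_lt : L.hD < L.hD + L.β := by linarith [L.β_pos]

/-- `Tu_lt` (auxiliary). [folklore] -/
theorem Tu_lt : L.hDu - L.β < L.hDu := by linarith [L.β_pos]

/-! ### Smoothness -/

/-- `e ∘ heightSquash` is `C^∞`. [folklore] -/
theorem contDiff_e_squash : ContDiff ℝ ∞ fun h ↦ L.e (heightSquash h) :=
  L.e_smooth.comp_contDiff contDiff_heightSquash fun h ↦ heightSquash_mem_Ioo h

/-- `e_squash_pos` (auxiliary). [folklore] -/
theorem e_squash_pos (h : ℝ) : 0 < L.e (heightSquash h) := L.e_pos _ (heightSquash_mem h)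

/-- `contDiff_ρc` (auxiliary). [folklore] -/
theorem contDiff_ρc : ContDiff ℝ ∞ L.ρc := by
  unfold ρc
  exact contDiff_const.sub (contDiff_const.div L.contDiff_e_squash fun h ↦ (L.e_squash_pos h).ne')

/-- `contDiff_ρlo` (auxiliary). [folklore] -/
theorem contDiff_ρlo : ContDiff ℝ ∞ L.ρlo := L.dl.contDiff_ρ₁

/-- `contDiff_ρup` (auxiliary). [folklore] -/
theorem contDiff_ρup : ContDiff ℝ ∞ L.ρup := L.du.contDiff_ρ₁.comp (contDiff_const.sub contDiff_id)

/-- `contDiff_T` (auxiliary). [folklore] -/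
theorem contDiff_T : ContDiff ℝ ∞ L.T := contDiff_smoothStep _ _

/-- `contDiff_Tu` (auxiliary). [folklore] -/
theorem contDiff_Tu : ContDiff ℝ ∞ L.Tu := contDiff_smoothStep _ _

/-- `contDiff_ρmid` (auxiliary). [folklore] -/
theorem contDiff_ρmid : ContDiff ℝ ∞ L.ρmid :=
  ((contDiff_const.sub L.contDiff_Tu).mul L.contDiff_ρc).add (L.contDiff_Tu.mul L.contDiff_ρup)

/-- **The loop profile is `C^∞`.** [folklore] -/
theorem contDiff_rho : ContDiff ℝ ∞ L.rho :=
  ((contDiff_const.sub L.contDiff_T).mul L.contDiff_ρlo).add (L.contDiff_T.mul L.contDiff_ρmid)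

/-! ### Values -/

/-- `ρc_mem` (auxiliary). [folklore] -/
theorem ρc_mem (h : ℝ) : L.ρc h ∈ Ioo (0 : ℝ) 1 := by
  have he := L.e_squash_pos h
  have hlt := L.rlow_lt _ (heightSquash_mem h)
  have hgt := L.rlow_gt
  rw [ρc]
  constructor
  · rw [sub_pos, div_lt_one he]; exact hlt
  · have : 0 < (L.rlow - 1) / L.e (heightSquash h) := div_pos (by linarith) he
    linarith

/-- `ρlo_mem` (auxiliary). [folklore] -/
theorem ρlo_mem (h : ℝ) : L.ρlo h ∈ Icc (0 : ℝ) 1 := L.dl.ρ₁_mem_Icc h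

/-- `ρup_mem` (auxiliary). [folklore] -/
theorem ρup_mem (h : ℝ) : L.ρup h ∈ Icc (0 : ℝ) 1 := L.du.ρ₁_mem_Icc _

/-- `T_mem` (auxiliary). [folklore] -/
theorem T_mem (h : ℝ) : L.T h ∈ Icc (0 : ℝ) 1 := smoothStep_mem_Icc _ _ _

/-- `Tu_mem` (auxiliary). [folklore] -/
theorem Tu_mem (h : ℝ) : L.Tu h ∈ Icc (0 : ℝ) 1 := smoothStep_mem_Icc _ _ _

/-- `ρmid_mem` (auxiliary). [folklore] -/
theorem ρmid_mem (h : ℝ) : L.ρmid h ∈ Icc (0 : ℝ) 1 := by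
  have h1 := L.ρc_mem h; have h2 := L.ρup_mem h; have h3 := L.Tu_mem h
  rw [ρmid]; constructor <;> nlinarith [h1.1, h1.2, h2.1, h2.2, h3.1, h3.2]

/-- **The loop profile takes values in `[0, 1]`.** [folklore] -/
theorem rho_mem (h : ℝ) : L.rho h ∈ Icc (0 : ℝ) 1 := by
  have h1 := L.ρlo_mem h; have h2 := L.ρmid_mem h; have h3 := L.T_mem h
  rw [rho]; constructor <;> nlinarith [h1.1, h1.2, h2.1, h2.2, h3.1, h3.2]

/-- **Below the lower tip height the loop is the lower rise.** [folklore] -/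
theorem rho_of_le_hD {h : ℝ} (hh : h ≤ L.hD) : L.rho h = L.ρlo h := by
  rw [rho, T, smoothStep_of_le L.T_lt hh]; ring

/-- `T_of_ge` (auxiliary). [folklore] -/
theorem T_of_ge {h : ℝ} (hh : L.hD + L.β ≤ h) : L.T h = 1 := smoothStep_of_ge L.T_lt hh

/-- `Tu_of_le` (auxiliary). [folklore] -/
theorem Tu_of_le {h : ℝ} (hh : h ≤ L.hDu - L.β) : L.Tu h = 0 := smoothStep_of_le L.Tu_lt hh

/-- `Tu_of_ge` (auxiliary). [folklore] -/
theorem Tu_of_ge {h : ℝ} (hh : L.hDu ≤ h) : L.Tu h = 1 := smoothStep_of_ge L.Tu_lt hh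

/-- **Above the upper tip height the loop is the upper rise.** [folklore] -/
theorem rho_of_ge_hDu {h : ℝ} (hh : L.hDu ≤ h) : L.rho h = L.ρup h := by
  have hsep := L.sep
  rw [rho, L.T_of_ge (by rw [hDu] at hh; rw [hD]; linarith [L.β_pos]), ρmid, L.Tu_of_ge hh]; ring

/-- **Across the middle heights the loop is the constant-radius arc.** [folklore] -/
theorem rho_of_mem_mid {h : ℝ} (hh : h ∈ Icc (L.hD + L.β) (L.hDu - L.β)) : L.rho h = L.ρc h := by
  rw [rho, L.T_of_ge hh.1, ρmid, L.Tu_of_le hh.2]; ring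

/-- The lower tip height is above the junction height `f a` of the lower track. [folklore] -/
theorem fa_lt_hD : L.dl.f L.dl.a < L.hD := by
  have h := L.dl.hr0_lt_of_lt_ρt (h := L.dl.Hh L.dl.tD) (by rw [L.dl.ρt_Hh_tD]; exact L.dl.one_sub_κ₀_lt_xD)
  rw [hD]; linarith [L.dl.fa_lt_hr0]

/-- The upper tip height is below the (reflected) junction height of the upper track. [folklore] -/
theorem hDu_lt : L.hDu < 1 - L.du.f L.du.a := by
  have h := L.du.hr0_lt_of_lt_ρt (h := L.du.Hh L.du.tD) (by rw [L.du.ρt_Hh_tD]; exact L.du.one_sub_κ₀_lt_xD)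
  rw [hDu]; linarith [L.du.fa_lt_hr0]

/-- **Below the lower junction height the loop profile vanishes.** [folklore] -/
theorem rho_of_le_fa {h : ℝ} (hh : h ≤ L.dl.f L.dl.a) : L.rho h = 0 := by
  rw [L.rho_of_le_hD (hh.trans L.fa_lt_hD.le), ρlo, L.dl.ρ₁_of_le_fa hh]

/-- **Above the (reflected) upper junction height the loop profile vanishes.** [folklore] -/
theorem rho_of_ge_fa {h : ℝ} (hh : 1 - L.du.f L.du.a ≤ h) : L.rho h = 0 := by
  rw [L.rho_of_ge_hDu (L.hDu_lt.le.trans hh), ρup, L.du.ρ₁_of_le_fa (by linarith)]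

end K1LoopData

/-! ## Part B: height graphs over the left edge as ends of ambient isotopies -/

namespace BandCore

variable {A B : Knot} {avoid : Set (Metric.sphere (0 : EuclideanSpace ℝ (Fin 4)) 1)} (c : BandCore A B avoid)

/-- The window cutoff in the parameter of `A`: `1` on `[alo + epsLo/2, ahi - epsHi/2]`, `0` off
`((thetaA (3/20) + alo + epsLo/2)/2, (ahi - epsHi/2 + thetaA (17/20))/2)`. [folklore] -/
def windowCut (s : ℝ) : ℝ :=
  smoothStep ((c.thetaA (3 / 20) + (c.alo + c.epsLo / 2)) / 2) (c.alo + c.epsLo / 2) s *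
    (1 - smoothStep (c.ahi - c.epsHi / 2) ((c.ahi - c.epsHi / 2 + c.thetaA (17 / 20)) / 2) s)

/-- The marks around the edge window: `thetaA (3/20) < alo + epsLo/2 < alo + epsLo` and
`ahi - epsHi < ahi - epsHi/2 < thetaA (17/20)`. [folklore] -/
theorem window_marks : c.thetaA (3 / 20) < c.alo + c.epsLo / 2 ∧ c.alo + c.epsLo / 2 < c.alo + c.epsLo ∧
    c.alo + c.epsLo < c.ahi - c.epsHi ∧ c.ahi - c.epsHi < c.ahi - c.epsHi / 2 ∧ c.ahi - c.epsHi / 2 < c.thetaA (17 / 20) := by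
  have hm := c.marks_lt
  have hε := c.epsLo_pos'
  have hε' := c.epsHi_bounds.1
  have h1 := c.alo_add_lt_tlo_sub
  have h2 := c.thi_add_lt_ahi_sub
  exact ⟨by linarith, by linarith, by linarith, by linarith, by linarith⟩

/-- `contDiff_windowCut` (auxiliary). [folklore] -/
theorem contDiff_windowCut : ContDiff ℝ ∞ c.windowCut :=
  (contDiff_smoothStep _ _).mul (contDiff_const.sub (contDiff_smoothStep _ _))

/-- `windowCut_mem` (auxiliary). [folklore] -/
theorem windowCut_mem (s : ℝ) : c.windowCut s ∈ Icc (0 : ℝ) 1 := by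
  have h1 := smoothStep_mem_Icc ((c.thetaA (3 / 20) + (c.alo + c.epsLo / 2)) / 2) (c.alo + c.epsLo / 2) s
  have h2 := smoothStep_mem_Icc (c.ahi - c.epsHi / 2) ((c.ahi - c.epsHi / 2 + c.thetaA (17 / 20)) / 2) s
  rw [windowCut]; constructor <;> nlinarith [h1.1, h1.2, h2.1, h2.2]

/-- `windowCut_of_mem` (auxiliary). [folklore] -/
theorem windowCut_of_mem {s : ℝ} (hs : s ∈ Icc (c.alo + c.epsLo / 2) (c.ahi - c.epsHi / 2)) : c.windowCut s = 1 := by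
  have hw := c.window_marks
  rw [windowCut, smoothStep_of_ge (by linarith) hs.1, smoothStep_of_le (by linarith) hs.2]; ring

/-- `windowCut_of_le` (auxiliary). [folklore] -/
theorem windowCut_of_le {s : ℝ} (hs : s ≤ (c.thetaA (3 / 20) + (c.alo + c.epsLo / 2)) / 2) : c.windowCut s = 0 := by
  have hw := c.window_marks
  rw [windowCut, smoothStep_of_le (by linarith) hs]; ring

/-- `windowCut_of_ge` (auxiliary). [folklore] -/
theorem windowCut_of_ge {s : ℝ} (hs : (c.ahi - c.epsHi / 2 + c.thetaA (17 / 20)) / 2 ≤ s) : c.windowCut s = 0 := by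
  have hw := c.window_marks
  rw [windowCut, smoothStep_of_ge (by linarith) hs]; ring

/-- `fLo = fUp = heightA` on `[thi, thetaA (17/20)]`. [folklore] -/
theorem fLo_eq_fUp {t : ℝ} (ht : t ∈ Icc c.thi (c.thetaA (17 / 20))) : c.fLo t = c.fUp t := by
  have hm := c.marks_lt
  rw [c.fLo_spec.2.1 t ⟨by linarith [ht.1], ht.2⟩, (c.fUp_eq_heightA ht).1]

/-- **Height graphs over the left edge are ends of ambient isotopies (the finger move).** Let
`ρ : ℝ → [0, 1]` be `C^∞`, vanishing below `fLo (alo + epsLo)` and above `fUp (ahi - epsHi)`, and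
`O` an open set containing the band points `band (u ρ (fLo s), fLo s)`, `u ∈ [0, 1]`, `s` in the edge
window `[thetaA (3/20), thetaA (17/20)]`. Then there are an ambient isotopy `F` of `S³`, stationary
off `O`, and a knot `k₁ = F 1 ∘ A` with `k₁ (circlePt s) = band (ρ (fLo s), fLo s)` on the edge window
and `k₁ = A` off it. (The finger family `BandData.exists_ambientIsotopy_edgeGraph` of the rebuilt
band data along the same band, with profile `windowCut · (ρ ∘ fLo)`.) [cite: Kirby1989, Ch. I §4] -/
theorem exists_ambientIsotopy_heightGraph (hAB : Disjoint (range ⇑A) (range ⇑B)) {ρ : ℝ → ℝ}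
    (hρ : ContDiff ℝ ∞ ρ) (hρI : ∀ h, ρ h ∈ Icc (0 : ℝ) 1)
    (h0lo : ∀ h, h ≤ c.fLo (c.alo + c.epsLo) → ρ h = 0) (h0up : ∀ h, c.fUp (c.ahi - c.epsHi) ≤ h → ρ h = 0)
    {O : Set (Metric.sphere (0 : EuclideanSpace ℝ (Fin 4)) 1)} (hO : IsOpen O)
    (hOsub : ∀ u ∈ Icc (0 : ℝ) 1, ∀ s ∈ Icc (c.thetaA (3 / 20)) (c.thetaA (17 / 20)),
      c.band (pt2 (u * ρ (c.fLo s)) (c.fLo s)) ∈ O) :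
    ∃ (F : AmbientIsotopy (𝓡 3) (Metric.sphere (0 : EuclideanSpace ℝ (Fin 4)) 1)) (k₁ : Knot),
      (∀ t y, y ∉ O → F.toFun t y = y) ∧ F.toFun 1 ∘ ⇑A = ⇑k₁ ∧
      (∀ s ∈ Icc (c.thetaA (3 / 20)) (c.thetaA (17 / 20)), k₁ (circlePt s) = c.band (pt2 (ρ (c.fLo s)) (c.fLo s))) ∧
      (∀ t ∈ Ico (c.thetaA 10⁻¹) (c.thetaA 10⁻¹ + 1), t ∉ Icc (c.thetaA (3 / 20)) (c.thetaA (17 / 20)) →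
        k₁ (circlePt t) = A (circlePt t)) := by
  have hw := c.window_marks
  have hm := c.marks_lt
  set b := c.rebuildData hAB with hb
  set ρe : ℝ → ℝ := fun s ↦ c.windowCut s * ρ (c.fLo s) with hρe
  -- the profile vanishes near the ends of the edge window anyway
  have hzero_lo : ∀ s, s ≤ c.alo + c.epsLo / 2 → ρ (c.fLo s) = 0 := fun s hs ↦
    h0lo _ ((c.strictMonoOn_fLo.monotoneOn (show s ∈ Iic _ by simp only [mem_Iic]; linarith)
      (show c.alo + c.epsLo ∈ Iic _ by simp only [mem_Iic]; linarith) (by linarith)))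
  have hzero_up : ∀ s ∈ Icc (c.ahi - c.epsHi / 2) (c.thetaA (17 / 20)), ρ (c.fLo s) = 0 := by
    intro s hs
    have h2 := c.thi_add_lt_ahi_sub
    have hε' := c.epsHi_bounds.1
    refine h0up _ ?_
    rw [c.fLo_eq_fUp ⟨by linarith [hs.1], hs.2⟩]
    exact c.strictMonoOn_fUp.monotoneOn (show c.ahi - c.epsHi ∈ Ici _ by simp only [mem_Ici]; linarith)
      (show s ∈ Ici _ by simp only [mem_Ici]; linarith [hs.1]) (by linarith [hs.1])
  have hρe_eq : ∀ s ∈ Icc (c.thetaA (3 / 20)) (c.thetaA (17 / 20)), ρe s = ρ (c.fLo s) := by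
    intro s hs
    simp only [hρe]
    rcases lt_or_ge s (c.alo + c.epsLo / 2) with h1 | h1
    · rw [hzero_lo s h1.le, mul_zero]
    rcases le_or_gt s (c.ahi - c.epsHi / 2) with h2 | h2
    · rw [c.windowCut_of_mem ⟨h1, h2⟩, one_mul]
    · rw [hzero_up s ⟨h2.le, hs.2⟩, mul_zero]
  have hρes : ContDiff ℝ ∞ ρe := c.contDiff_windowCut.mul (hρ.comp c.fLo_spec.1)
  have hρe0 : ∀ t, t ∉ Ioo ((c.thetaA (3 / 20) + (c.alo + c.epsLo / 2)) / 2) ((c.ahi - c.epsHi / 2 + c.thetaA (17 / 20)) / 2) →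
      ρe t = 0 := by
    intro t ht
    simp only [hρe]
    rcases le_or_gt t ((c.thetaA (3 / 20) + (c.alo + c.epsLo / 2)) / 2) with h | h
    · rw [c.windowCut_of_le h, zero_mul]
    · have h2 : (c.ahi - c.epsHi / 2 + c.thetaA (17 / 20)) / 2 ≤ t := by
        by_contra h2; exact ht ⟨h, lt_of_not_ge h2⟩
      rw [c.windowCut_of_ge h2, zero_mul]
  have hρenn : ∀ t, 0 ≤ ρe t := fun t ↦ mul_nonneg (c.windowCut_mem t).1 (hρI _).1
  have hρelt : ∀ t, ρe t < 1 + b.δ := fun t ↦ by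
    have h1 := (c.windowCut_mem t).2; have h2 := (hρI (c.fLo t)).2
    have hδ : 0 < b.δ := b.δ_pos
    calc ρe t ≤ 1 := by simp only [hρe]; nlinarith [(c.windowCut_mem t).1, (hρI (c.fLo t)).1]
      _ < 1 + b.δ := by linarith
  -- the finger family of the rebuilt band data (same band, same edge heights)
  have hband : ∀ x, b.band x = c.band x := fun x ↦ rfl
  have hfLo : ∀ s, b.fLo s = c.fLo s := fun s ↦ rfl
  have hthetaA : ∀ y, b.thetaA y = c.thetaA y := fun y ↦ rfl
  have hOsub' : ∀ u ∈ Icc (0 : ℝ) 1, ∀ s ∈ Icc (b.thetaA (3 / 20)) (b.thetaA (17 / 20)),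
      b.band (pt2 (u * ρe s) (b.fLo s)) ∈ O := by
    intro u hu s hs
    rw [hband, hfLo, hρe_eq s hs]
    exact hOsub u hu s hs
  obtain ⟨F, k₁, hFO, hFA, hk₁, hk₁'⟩ := b.exists_ambientIsotopy_edgeGraph hρes
    (s₁' := (c.thetaA (3 / 20) + (c.alo + c.epsLo / 2)) / 2) (s₂' := (c.ahi - c.epsHi / 2 + c.thetaA (17 / 20)) / 2)
    (by rw [hthetaA]; linarith) (by linarith) (by rw [hthetaA]; linarith) hρe0 hρenn hρelt hO hOsub'
  refine ⟨F, k₁, hFO, hFA, fun s hs ↦ ?_, fun t ht hts ↦ hk₁' t ht hts⟩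
  rw [hk₁ s hs, hband, hfLo, hρe_eq s hs]

end BandCore

end Literature.Topology.FourManifolds
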